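import Summits.BirchSwinnertonDyer.BirchSwinnertonDyer.Theorems.BiquadraticEisensteinDescentHeegnerTwistCouplingInSupplySylvesterTwistThreeAdicImage
import Literature.NumberTheory.NumberFields.AdicCompletionIntegersPadicIntOfDegreeOne
import Literature.NumberTheory.EllipticCurves.MordellCurveThreeDescentLocalConverse
import HarnessLib

set_option linter.dupNamespace false -- `Summit.BirchSwinnertonDyer.BirchSwinnertonDyer.Theorems.…` (summit = sub, D-0017)
set_option autoImplicit false

/-!
# Crux `HeegnerTwistCouplingInSupply` (stmt-BirchSwinnertonDyer-21381) — programme «TWISTED 3-ISOGENY DESCENT», file P6b: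
# the `φ̂`-side local condition at a prime `𝔮 ∣ 3` of `K = ℚ(√−2)` is «`u` is a cube in `K_𝔮`»

Route `BiquadraticEisensteinDescent` (cell `pub/bsd-wall`, width seat `bsd-wall-cm-bed-w4` g32; `--supports` 21381, helper). For the
`φ̂`-side of the descent on `W_p^{(−8)} ≅ y² = x³ − 2p²` (`p ≡ 8 (mod 9)`) the Kummer field is a quadratic number field `K ∋ θ`,
`θ² = −2`; the `μ₃`-kernel Mordell datum over `K` is `E' = mordellCurve(−3c'²)`, `c' = 3pθ` (`−3c'² = 54p²`), with partner
`mordellCurve(81c'²) : Y² = X³ − 1458p²` and descent map `phiDescent c' : (X, Y) ↦ Y + 9c' = Y + 27pθ`. The prime `3` SPLITS in `K`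
(`−2 ≡ 1 (mod 3)`): for a prime `𝔮 ∌ 3̸`, `𝔮 ∋ 3`, with conjugate `𝔮̄ ≠ 𝔮`, the completion is `K_𝔮 ≅ ℚ₃` (tree
`padicEquivOfDegreeOne`), `θ ↦ s` with `s² = −2`, and `27pθ ↦ 3³·(ps)` — so the LANDED `3`-adic triviality
(`SylvesterTwistDescent.cubicDescent_eq_cube_of_sq_toZModPow_eq_seven`, file P1b) transports:

* §1 transport of the coordinate statements along a ring isomorphism `e : K_𝔮 ≃+* ℚ₃`;
* §2 ★ `phiDescent_eq_cube_adicCompletion_three` — for EVERY `K_𝔮`-point `P` of `Y² = X³ + 81c'²`, `phiDescent c' P` is a NON-ZERO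
  CUBE of `K_𝔮`;
* §3 ★★ `isCube_adicCompletion_three_of_torsorClass_mem_sha` — hence if `[C_u] ∈ Ш(E'/K)` then `u` is a cube in `K_𝔮`
  (tree `exists_phiDescent_eq_adicCompletion_of_torsorClass_mem_sha`: `phiDescent c' P = u w³`).

HONEST FRAMING: a local lemma of a support-layer programme on ONE CM family; the crux (residual C⁺), its registered stubs, `hDescU`
itself and BSD are untouched. THEOREMS ONLY (no `def`, no named fact, no sorry). Supports stmt-BirchSwinnertonDyer-21381.
[cite: CohenPazuki2009, §4] [cite: SilvermanAEC2009, Thm. X.4.2 (a), Prop. X.4.9] [cite: FrohlichTaylor1990, Ch. III §1 (1.14)(a)]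
-/

noncomputable section

open scoped Classical

namespace Summit.BirchSwinnertonDyer.BirchSwinnertonDyer.Theorems.SylvesterTwistDescent

open Literature.NumberTheory.EllipticCurves Literature.NumberTheory.EllipticCurves.MordellDescent
open Literature.NumberTheory.NumberFields IsDedekindDomain NumberField

/-! ## §1 Transport of the `3`-adic statement along `e : L ≃+* ℚ₃` -/

section Transport

variable {L : Type*} [Field L] (e : L ≃+* ℚ_[3]) {S : ℤ_[3]} (hS : PadicInt.toZModPow 2 (S ^ 2) = 7)
  {t : L} (ht : t ≠ 0) {B : L} (hB : e B = e t ^ 3 * (S : ℚ_[3]))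
include hS ht hB

/-- Transport of `exists_add_S_eq_cube` (rescaled by `t³`): on `Y² = X³ + B²` over `L`, `Y + B` is `0` or a non-zero cube. [cite: CohenPazuki2009, §4] -/
theorem exists_add_eq_cube_of_equiv {X Y : L} (h : Y ^ 2 = X ^ 3 + B ^ 2) (hne : Y + B ≠ 0) : ∃ w : L, w ≠ 0 ∧ Y + B = w ^ 3 := by
  have het : e t ≠ 0 := (map_ne_zero e).mpr ht
  -- rescale: `y = e Y / (e t)³`, `x = e X / (e t)²`
  set x : ℚ_[3] := e X / e t ^ 2 with hx
  set y : ℚ_[3] := e Y / e t ^ 3 with hy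
  have hX : e X = x * e t ^ 2 := by rw [hx, div_mul_cancel₀ _ (pow_ne_zero 2 het)]
  have hY : e Y = y * e t ^ 3 := by rw [hy, div_mul_cancel₀ _ (pow_ne_zero 3 het)]
  have heq : y ^ 2 = x ^ 3 + (S : ℚ_[3]) ^ 2 := by
    have h' := congrArg e h
    rw [map_pow, map_add, map_pow, map_pow, hB, hX, hY] at h'
    have ht6 : e t ^ 6 ≠ 0 := pow_ne_zero 6 het
    apply mul_right_cancel₀ ht6
    linear_combination h'
  have hne' : y + S ≠ 0 := by
    intro h0
    apply hne
    apply e.injective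
    rw [map_add, map_zero, hY, hB, show y = -(S : ℚ_[3]) by linear_combination h0]; ring
  obtain ⟨w, hw0, hw⟩ := exists_add_S_eq_cube hS heq hne'
  refine ⟨e.symm (e t * w), by rw [map_ne_zero_iff _ e.symm.injective]; exact mul_ne_zero het hw0, ?_⟩
  apply e.injective
  rw [map_add, hY, hB, map_pow, RingEquiv.apply_symm_apply, mul_pow, ← hw]; ring

/-- Transport of `exists_two_mul_S_eq_cube`: `2B` is a non-zero cube of `L`. [cite: CohenPazuki2009, §4] -/
theorem exists_two_mul_eq_cube_of_equiv : ∃ w : L, w ≠ 0 ∧ 2 * B = w ^ 3 := by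
  have het : e t ≠ 0 := (map_ne_zero e).mpr ht
  obtain ⟨w, hw0, hw⟩ := exists_two_mul_S_eq_cube hS
  refine ⟨e.symm (e t * w), by rw [map_ne_zero_iff _ e.symm.injective]; exact mul_ne_zero het hw0, ?_⟩
  apply e.injective
  rw [map_mul, map_ofNat, hB, map_pow, RingEquiv.apply_symm_apply, mul_pow, ← hw]; ring

/-- ★ **Transported triviality**: every value of `cubicDescent B` on `Y² = X³ + B²` over `L ≅ ℚ₃` (`B ↦ t³S`, `S² ≡ 7 (mod 9)`) is a
non-zero cube of `L`. [cite: CohenPazuki2009, §4] -/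
theorem cubicDescent_eq_cube_of_equiv {W : WeierstrassCurve L} (hW : W = mordellCurve (B ^ 2)) (P : W.toAffine.Point) :
    ∃ w : L, w ≠ 0 ∧ cubicDescent W B P = w ^ 3 := by
  rcases P with _ | ⟨X, Y, hXY⟩
  · exact ⟨1, one_ne_zero, by rw [← WeierstrassCurve.Affine.Point.zero_def, cubicDescent_zero, one_pow]⟩
  · have hE : Y ^ 2 = X ^ 3 + B ^ 2 := by
      have := hXY.left
      rw [hW, mordellCurve_equation_iff] at this
      exact this
    by_cases hYB : Y = -B
    · rw [cubicDescent_some_of_eq _ hXY hYB]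
      obtain ⟨w, hw0, hw⟩ := exists_two_mul_eq_cube_of_equiv e hS ht hB
      exact ⟨w ^ 2, pow_ne_zero 2 hw0, by rw [hw]; ring⟩
    · rw [cubicDescent_some_of_ne _ hXY hYB]
      exact exists_add_eq_cube_of_equiv e hS ht hB hE (fun h0 => hYB (by linear_combination h0))

end Transport

/-! ## §2 The prime `𝔮 ∣ 3` of `K ∋ √−2`: `K_𝔮 ≅ ℚ₃` and the triviality of the local image -/

section ThreeAdic

variable {K : Type} [Field K] [NumberField K] (hK2 : Module.finrank ℚ K = 2) {θ : K} (hθ : θ ^ 2 = -2)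
  {𝔮 𝔮' : HeightOneSpectrum (𝓞 K)} (h𝔮 : ((3 : ℕ) : 𝓞 K) ∈ 𝔮.asIdeal) (h𝔮' : ((3 : ℕ) : 𝓞 K) ∈ 𝔮'.asIdeal) (hne : 𝔮' ≠ 𝔮)
  {p : ℕ} (hp : p % 9 = 8)
include hK2 hθ h𝔮 h𝔮' hne hp

/-- ★ **The local image at `𝔮 ∣ 3` is trivial**: for `c' = 3pθ` (`θ² = −2`, `p ≡ 8 (mod 9)`) every value `phiDescent c' P`,
`P` a `K_𝔮`-point of `Y² = X³ + 81c'²`, is a non-zero cube of `K_𝔮` (`K_𝔮 ≅ ℚ₃`, `9c' ↦ 3³·(p s)`, `s² = −2`, and P1b).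
[cite: CohenPazuki2009, §4] [cite: FrohlichTaylor1990, Ch. III §1 (1.14)(a)] -/
theorem phiDescent_eq_cube_adicCompletion_three
    (P : (mordellCurve (81 * algebraMap K (𝔮.adicCompletion K) (3 * p * θ) ^ 2)).toAffine.Point) :
    ∃ w : 𝔮.adicCompletion K, w ≠ 0 ∧ phiDescent (algebraMap K (𝔮.adicCompletion K) (3 * p * θ)) P = w ^ 3 := by
  haveI : Fact (Nat.Prime 3) := ⟨Nat.prime_three⟩
  haveI := liesOver_ratPlace_of_natCast_mem K 𝔮 h𝔮
  obtain ⟨he, hf⟩ := ramificationIdx_eq_one_and_inertiaDeg_eq_one_of_natCast_mem_of_ne K hK2 h𝔮 h𝔮' hne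
  set e : 𝔮.adicCompletion K ≃+* ℚ_[3] := padicEquivOfDegreeOne K 3 𝔮 he hf with he_def
  set ψ : K →+* ℚ_[3] := e.toRingHom.comp (algebraMap K (𝔮.adicCompletion K)) with hψ
  have hψ_apply : ∀ x : K, ψ x = e (algebraMap K (𝔮.adicCompletion K) x) := fun x => rfl
  -- `s = ψ(θ)`, `s² = −2`, `s ∈ ℤ₃`
  set s : ℚ_[3] := ψ θ with hs_def
  have hs2 : s ^ 2 = -2 := by rw [hs_def, ← map_pow, hθ, map_neg, map_ofNat]
  have hs1 : ‖s‖ = 1 := by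
    have h2 : ‖s‖ ^ 2 = ‖(2 : ℚ_[3])‖ := by rw [← norm_pow, hs2, norm_neg]
    have h2' : ‖(2 : ℚ_[3])‖ = 1 := by
      rw [show (2 : ℚ_[3]) = ((2 : ℕ) : ℚ_[3]) by norm_cast, Padic.norm_eq_zpow_neg_valuation (by norm_num),
        Padic.valuation_natCast]
      norm_num [padicValNat.eq_zero_of_not_dvd]
    rw [h2'] at h2
    nlinarith [norm_nonneg s, h2]
  set sZ : ℤ_[3] := ⟨s, hs1.le⟩ with hsZ
  have hsZ2 : sZ ^ 2 = -2 := by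
    apply Subtype.coe_injective
    change s ^ 2 = ((-2 : ℤ_[3]) : ℚ_[3])
    rw [hs2]; push_cast; rw [padicInt_coe_ofNat]
  have hS := sq_toZModPow_eq_seven_of_sylvester hp hsZ2
  -- the parameters of the transport: `t = 3`, `B = 9 c'`, `e B = 27 p s = (e 3)³ · (p s)`
  have ht : (3 : 𝔮.adicCompletion K) ≠ 0 := by
    rw [← map_ofNat (algebraMap K (𝔮.adicCompletion K)) 3]
    exact (map_ne_zero_iff _ (algebraMap K (𝔮.adicCompletion K)).injective).mpr three_ne_zero
  have hB : e (9 * algebraMap K (𝔮.adicCompletion K) (3 * p * θ)) =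
      e (3 : 𝔮.adicCompletion K) ^ 3 * ((((p : ℤ_[3]) * sZ : ℤ_[3])) : ℚ_[3]) := by
    rw [map_mul, map_ofNat, map_ofNat, ← hψ_apply, map_mul, map_mul, map_natCast, map_ofNat]
    push_cast
    rw [hsZ]; change _ = _ * ((p : ℚ_[3]) * s); ring
  have hW : mordellCurve (81 * algebraMap K (𝔮.adicCompletion K) (3 * p * θ) ^ 2) =
      mordellCurve ((9 * algebraMap K (𝔮.adicCompletion K) (3 * p * θ)) ^ 2) := by
    congr 1; ring
  obtain ⟨w, hw0, hw⟩ := cubicDescent_eq_cube_of_equiv e hS ht hB hW P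
  exact ⟨w, hw0, by rw [phiDescent_eq_cubicDescent]; exact hw⟩

/-- ★★ **The `φ̂`-side local condition at `𝔮 ∣ 3`**: if `[C_u] ∈ Ш(E'/K)` for the `μ₃`-kernel Mordell datum `E' = mordellCurve(−3c'²)`,
`c' = 3pθ`, then `u` is a CUBE in `K_𝔮` (`phiDescent c' P = u·w³` for a `K_𝔮`-point `P`, and the left side is a cube).
[cite: SilvermanAEC2009, Thm. X.4.2 (a) and Prop. X.4.9] [cite: CohenPazuki2009, §4] -/
theorem exists_eq_cube_adicCompletion_three_of_torsorClass_mem_sha (hc : (3 * p * θ : K) ≠ 0) {D : K}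
    (hD : D = -3 * (3 * p * θ) ^ 2) {u : K} (hu : u ≠ 0) (hsha : torsorClass hc hD hu ∈ (mordellCurve D).sha) :
    ∃ z : 𝔮.adicCompletion K, z ≠ 0 ∧ algebraMap K (𝔮.adicCompletion K) u = z ^ 3 := by
  obtain ⟨P, w, hw0, hPw⟩ := exists_phiDescent_eq_adicCompletion_of_torsorClass_mem_sha hc hD hu hsha 𝔮
  obtain ⟨v, hv0, hv⟩ := phiDescent_eq_cube_adicCompletion_three hK2 hθ h𝔮 h𝔮' hne hp P
  refine ⟨v / w, div_ne_zero hv0 hw0, ?_⟩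
  rw [div_pow, eq_div_iff (pow_ne_zero 3 hw0), ← hv, hPw]

end ThreeAdic

end Summit.BirchSwinnertonDyer.BirchSwinnertonDyer.Theorems.SylvesterTwistDescent

end
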